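import Literature.NumberTheory.EllipticCurves.Zhai2021.TwoAdicLowerBoundTwists
import Literature.NumberTheory.EllipticCurves.CoatesLiTianZhai2015.QuadraticTwistsX049
import Literature.NumberTheory.EllipticCurves.ImaginaryPeriod
import HarnessLib

/-!
# Adachi–Nomoto–Shii 2026, *The 2-adic valuations of the algebraic central L-values for quadratic twists of weight 2 newforms* (Acta Arith.): Thms. 4.1–4.4 AS PRINTED

HONEST FRAMING (cell `b2b-bsdres`, sub-lane `bsd-p2`, run/shared/lean/b2b/bsd-rank1-residual/p2/;
literature typer 1, mandate (iv), GEN 2 pass-2; lit-2's pointer T2-H4 (d) "NEW PRINT … a strictly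
larger printed `r = 0` analytic-side `2`-adic statement than Zhai 2016 / Cai–Li–Zhai 2020"): PUBLISHED
theorems vendored as named `Prop`s (nothing asserted, nothing discharged; D-0014), every printed
hypothesis a binder, locators into the held text. EVIDENCE of what print says at `p = 2`: for the
OPTIMAL curve `E` of a rational weight-`2` newform `f` with Manin constant `1`, LOWER BOUNDS, with
printed EQUALITY CASES, for `v₂(L(f, χ_M, 1)/Ω_f^{sgn χ_M})` over quadratic characters of conductor
`M = 4ⁿ m`, `(M, N) = 1` — i.e. ANALYTIC-RANK-ZERO information for the twists `E^{(εm)}`, INCLUDING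
`εm ≡ 3 (mod 4)` (`n = 1`), the case absent from Zhai 2016 / 2021, Cai–Li–Zhai 2020, Shu–Zhai 2021.
Nothing booked; no mark moved.

Source. T. Adachi, K. Nomoto, R. Shii, *The 2-adic valuations of the algebraic central L-values for
quadratic twists of weight 2 newforms*, Acta Arith. (2026), doi:10.4064/aa240320-5-10 =
arXiv:2403.11474v3 [AdachiNomotoShii2026]. Text read: the arXiv PDF (`paper:arxiv-2403.11474`, private
cache of this seat; pNNNN = PDF page, L = pdftotext line).

## The printed statements (verbatim, displayed formulas linearised)

* §1 (p0001 L34–p0002 L15): "`f ∈ S₂(Γ₀(N))^{new}` … `L(E/ℚ, s) = L(f, s)` … Let `m ≥ 1` be a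
  square-free odd integer and `ε ∈ {±1}`. Then, the `L`-function of the quadratic twist `E^{(εm)}` is
  equal to the twisted `L`-function `L(f, χ_M, s)`. Here, `χ_M` is a primitive quadratic character with
  conductor `M`, where `M = m` (`εm ≡ 1 mod 4`), `4m` (`εm ≡ 3 mod 4`). … there exist periods
  `Ω_f^± ∈ ℝ` such that `L_f = Ω_f⁺ ℤ + iΩ_f⁻ ℤ`, or `L_f = Ω_f⁺ ℤ + ((Ω_f⁺ + iΩ_f⁻)/2) ℤ`. The period
  lattice `L_f` is called rectangular in the former case and non-rectangular in the latter case. …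
  `S_i := {q : odd prime | q ∤ N, v₂(a_q − 2) = i}` … `v₂` the `2`-adic valuation of `ℚ` normalized so
  that `v₂(2) = 1`." Thm. 1.1 (p0002 L16–L29): "Assume that the Manin constant for `E` is equal to
  `1` …".
* §2 (p0004 L12–L21, L39–L55, L72–L94): "`f` corresponds to a `ℚ`-isogeny class … We write the optimal
  elliptic curve in the isogenous class as `E`. … Fix a global minimal Weierstrass model of `E` and let
  `ω` be the Néron differential … `ν_E f(q)dq/q = Φ*ω_E` (4). The number `ν_E` is called the Manin
  constant … In the rest of the paper, we assume that `ν_E = 1`. … `L_E = Ω_E⁺ℤ + iΩ_E⁻ℤ` (`Δ(E) < 0`),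
  `Ω_E⁺ℤ + ((Ω_E⁺ + iΩ_E⁻)/2)ℤ` (`Δ(E) > 0`) [sic — see the MISPRINT note below] … `L_E = L_f` …
  `Ω_f^± = Ω_E^±` … `[r]⁺ := ⟨r⟩⁺/Ω_f⁺`, `[r]⁻ := ⟨r⟩⁻/(iΩ_f⁻)` … `[r]^± ∈ ℚ` … `[0]⁺` is equal to the
  algebraic part `L(f, 1)/Ω_f⁺`." Thm. 2.1 (p0005 L4–L18, "cf. [Manin, Thm. 9.9]"):
  "`τ(χ_M) L(f, χ_M, 1)/Ω_f^{sgn(χ_M)} = ∑_{k ∈ (ℤ/Mℤ)^×} χ_M(k) [k/M]^{sgn(χ_M)}`. In particular,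
  `L(f, χ_M, 1)/Ω_f^{sgn(χ_M)}` is algebraic." §3 (p0005 L20–L22): "Let `M = 4ⁿm = 4ⁿq₁⋯q_r` be an
  integer with `(M, N) = 1`, where `n ∈ {0, 1}` and `q₁, …, q_r` are distinct odd primes."
  (p0006 L10–L11): "`T₁ := [0]⁺ = L(f,1)/Ω_f⁺` and `T₄ := 2[1/4]⁻ = τ(χ₄)L(f, χ₄, 1)/Ω_f⁻`".
* §4 (p0010 L93–p0010 L110): "Let `M = 4ⁿm` be a positive integer with `(M, N) = 1`, where `n ∈ {0, 1}`
  and `m` is a square-free odd integer. We define `r(m)` as the number of the prime divisors of `m`. We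
  set `v_m = min_{q ∣ m prime} {v₂(a_q − 2)}` and `w_m = 0` (`v_m = 0`), `1` (`v_m ≥ 1`). Moreover, for an
  integer `i`, we define `S_i^± = {q : odd prime | q ∤ N, sgn(χ_q) = ±1, v₂(a_q − 2) = i}` and set
  `S_i = S_i⁺ ∪ S_i⁻`." (p0005 L2–L3: "for a odd prime number `q`, the sign `sgn(χ_q) := χ_q(−1)` is `+1`
  if and only if `q ≡ 1 mod 4`".) "`δ_{i,j}` denotes the Kronecker delta" (p0011 L3).
* **Theorem 4.1** (Rectangular, `n = 0`) (p0011 L4–L51): "We assume that `L_f` is rectangular and `n = 0`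
  and write `m = q₁⋯q_{r(m)}`. (i) If `q_i ∈ S₀ ∪ S₁ ∪ S₂` for all `i`, then (12)
  `v₂(L(f,χ_m,1)/Ω_f^{sgn(χ_m)}) ≥ w_m·r(m) + min{δ_{v_m,0}, v₂(L(f,1)/Ω_f⁺)}`. (ii) If
  `q_i ∈ S₀⁺ ∪ S₁⁺ ∪ S₂⁺` for all `i`, then (13)
  `v₂(L(f,χ_m,1)/Ω_f^{sgn(χ_m)}) ≥ w_m·r(m) + min{1 + δ_{v_m,0}, v₂(L(f,1)/Ω_f⁺) + δ_{v_m,2}}`. In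
  particular, if `v₂(L(f,1)/Ω_f⁺) = 1` and `q_i ∈ S₀⁺` for all `i`, or `v₂(L(f,1)/Ω_f⁺) < 1` and
  `q_i ∈ S₁⁺` for all `i`, then the equality in the inequality (13) holds."
* **Theorem 4.2** (Non-rectangular, `n = 0`) (p0011 L52–L102): "(i) If `q_i ∈ S₀ ∪ S₁ ∪ S₂` for all `i`,
  then (14) `v₂(L(f,χ_M,1)/Ω_f^{sgn(χ_M)}) ≥ w_m·r(m) + min{δ_{v_m,0}, v₂(L(f,1)/Ω_f⁺)}`. In particular, if
  `v₂(L(f,1)/Ω_f) = 0` and `q_i ∈ S₀` for all `i`, then the equality in the inequality (14) holds. (ii) If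
  `q_i ∈ S₀⁺ ∪ S₁⁺ ∪ S₂⁺` for all `i`, then
  `v₂(L(f,χ_M,1)/Ω_f^{sgn(χ_M)}) ≥ w_m·r(m) + min{δ_{v_m,0}, v₂(L(f,1)/Ω_f⁺) + δ_{v_m,2}}` (15). In
  particular, if `v₂(L(f,1)/Ω_f⁺) = 0` and `q_i ∈ S₀⁺` for all `i`, or `v₂(L(f,1)/Ω_f⁺) < 0` and
  `q_i ∈ S₁⁺`, then the equality in the inequality (15) holds."
* **Theorem 4.3** (Rectangular, `n = 1`) (p0011 L103–L157): "(i) If `q_i ∈ S₀ ∪ S₁ ∪ S₂` for all `i`,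
  then `v₂(L(f,χ_M,1)/Ω_f^{sgn(χ_M)}) ≥ w_m·r(m) + min{−1 + δ_{v_m,0}, −1 + δ_{v_m,0} + v₂(L(f,1)/Ω_f⁺),
  v₂(L(f,χ₄,1)/Ω_f⁻) + δ_{v_m,2}}` (16). (ii) If `q_i ∈ S₀⁺ ∪ S₁⁺ ∪ S₂⁺` for all `i`, then
  `v₂(L(f,χ_M,1)/Ω_f^{sgn(χ_M)}) ≥ w_m·r(m) + min{δ_{v_m,0}, v₂(L(f,χ₄,1)/Ω_f⁻) + δ_{v_m,2}}` (17). In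
  particular, if `v₂(L(f,χ₄,1)/Ω_f⁻) = 0` and `q_i ∈ S₀⁺` for all `i`, then the equality in the
  inequality (17) holds."
* **Theorem 4.4** (Non-rectangular, `n = 1`) (p0012 L1–L58): "(i) If `q_i ∈ S₀ ∪ S₁ ∪ S₂` for all `i`,
  then `v₂(L(f,χ_M,1)/Ω_f^{sgn(χ_M)}) ≥ w_m·r(m) + min{−1 + δ_{v_m,0}, −1 + δ_{v_m,0} + v₂(L(f,1)/Ω_f⁺),
  v₂(L(f,χ₄,1)/Ω_f⁻) + δ_{v_m,2}}` (18). In particular, if `v₂(L(f,χ₄,1)/Ω_f⁻) = −1` and `q_i ∈ S₀` for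
  all `i`, then the equality in the inequality (18) holds. (ii) If `q_i ∈ S₀⁺ ∪ S₁⁺ ∪ S₂⁺` for all `i`,
  then `v₂(L(f,χ_M,1)/Ω_f^{sgn(χ_M)}) ≥ w_m·r(m) + min{−1 + δ_{v_m,0}, v₂(L(f,χ₄,1)/Ω_f⁻) + δ_{v_m,2}}`
  (19). In particular, if `v₂(L(f,χ₄,1)/Ω_f⁻) = −1` and `q_i ∈ S₀⁺` for all `i`, then the equality in
  the inequality (19) holds." Remark 4.5 (p0012 L59–L79): in 4.1 (i) the natural equality condition
  (`v₂(T₁) < 1`, `q_i ∈ S₀`) is EMPTY by Prop. 3.9; Table 1 lists equality / non-emptiness conditions.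
* Relations to earlier print (p0002 L47–L64): Zhai 2016 Thm. 1.1 is "a special case of Theorem 4.2-(i)"
  (`E[2](ℚ) = {O}` and `q` inert in the cubic field `⇒ a_q` odd); Cai–Li–Zhai 2020 "is a special case of
  Theorem 4.1-(ii) and Theorem 4.2-(ii)".

## MISPRINT flag (recorded, not silently corrected)

The displayed `L_E` in §2 (5) attaches "`Δ(E) < 0`" to the RECTANGULAR shape `Ω⁺ℤ + iΩ⁻ℤ` and
"`Δ(E) > 0`" to the non-rectangular one. For the Néron lattice of a real curve the rectangular shape is
the case `Δ > 0` (two real components) and `[Ω⁺, (Ω⁺ + iΩ⁻)/2]` is the case `Δ < 0` (Cremona,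
*Algorithms* §3.7; Zhai 2016 §3, arXiv:1409.0231 chunk p0007 L5–L15, quoted in
`Zhai2016/NonvanishingQuadraticTwists.lean`), and the paper's OWN examples agree with this: §5.1
(p0015 L1–L5) "`L_{f₁}` is rectangular … `34a1`" (`Δ = 2⁶·17 > 0`), §5.2 (p0015 L16–L20) "the period
lattice of `f₂` is rectangular … `37a1`" (`Δ = 37 > 0`). The theorems are stated in terms of the
SHAPE ("`L_f` is rectangular"), which is what this file renders: `IsRectangular W := 0 < Δ(W)`
(`Λ ∩ ℝ + Λ ∩ iℝ = Λ`), non-rectangular `:= Δ(W) < 0`.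

## The `p = 2` flag of this file

Natively AT 2, ANALYTIC side only (central values of rank-`0`-type twists; no Selmer / `Ш` statement
beyond "finite for such `M`" in Thm. 1.1, not vendored), ALLOWS-2: no parity-of-`p`, image, CM or
reduction-type-at-`2` hypothesis. Restricting hypotheses: `E` OPTIMAL with MANIN CONSTANT `1` (assumed,
p0004 L21); `(M, N) = 1` — so for `n = 1` (twists by `εm ≡ 3 (mod 4)`, conductor `4m` characters) the
LEVEL `N` IS ODD; twisting primes `q ∤ N` odd with `v₂(a_q − 2) ≤ 2` (so `a_q ≢ 2 (mod 8)`; `a_q = 2`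
excluded); `r(m) ≥ 1` (else `v_m` is undefined). The equality clauses are the census-usable part
(exact `v₂`); the inequalities are support statements.

## Transcription (tree dictionary) — the CURRENCY (checked numerically, see the row T1-M7 of
## p2/LIT-STATUS.md §T1 addendum 5; EVIDENCE, kit job cited there)

* `E` optimal with `ν_E = 1`: globally minimal `W`, `N = W.conductorNorm ℤ`, datum
  `Dt : ModularParametrizationData W N` with `Zhai2021.IsOptimalDatum W Dt` (lattice equality
  `Λ_E = ν_E Λ_f`) and `Dt.c.natAbs = 1`.
* `Ω_f⁺ = Ω_E⁺` = least positive real period of the Néron lattice = `CoatesLiTianZhai2015.leastRealPeriod W`;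
  `Ω_f⁻ = Ω_E⁻` = least `t > 0` with `it ∈ L_E` (both shapes) = `W.imaginaryPeriodRat`
  (`ImaginaryPeriod.lean`, Pal's `|Ω⁻(E)|`).
* The twist: `D = εm` (odd square-free, `|D| = m`), `E^{(εm)}` = any globally minimal model `WD` of
  `W.quadraticTwist D`; `M = twistCharConductor D` (`= m` if `D ≡ 1 (mod 4)`, `4m` if `D ≡ 3 (mod 4)`),
  `n = 1 ⟺ D ≡ 3 (mod 4)`; `sgn(χ_M) = sign D`; `Ω_f^{sgn(χ_M)}` = `periodSgn W D`.
* "`v₂(L(f,χ_M,1)/Ω_f^{sgn(χ_M)})`": by Thm. 2.1 (`τ(χ_M)·L/Ω^{sgn} ∈ ℚ`, with Gauss's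
  `τ(χ_M) = √M` resp. `i√M` and the odd-character period read as `iΩ⁻` as in `[r]⁻`) there is a
  RATIONAL `x` with `L(E^{(D)},1) = x · Ω^{sgn D}(E)/√M` (`IsAlgPart W WD D x`), and the printed
  valuation — `v₂` "of `ℚ`" extended to the algebraic number `x/√M` — equals `v₂(x) − n`. So a printed
  inequality `v₂(…) ≥ B` is rendered `val₂ x ≥ B + n` and a printed equality `v₂(…) = B` as
  `val₂ x = B + n`, where `val₂ x ∈ WithTop ℤ` is `v₂ x` for `x ≠ 0` and `⊤` for `x = 0` (so that
  `L(E^{(D)},1) = 0` satisfies every lower bound and no equality, exactly as `v₂(0) = +∞` does in print;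
  Mathlib's junk `padicValRat 2 0 = 0` never enters). Likewise `T₁`: `L(E,1) = x₁ · Ω⁺(E)`,
  `v₂(L(f,1)/Ω_f⁺) = val₂ x₁` (possibly `⊤`, e.g. `37a1`); and `v₂(L(f,χ₄,1)/Ω_f⁻) = val₂ x₄ − 1` for
  the rational `x₄` of the twist by `−1` (`D = −1`, `M = 4`: `L(E^{(−1)},1) = x₄·Ω⁻(E)/2`; `x₄ = T₄`).
  The `−1`'s of (16), (18), (19) and of `v₂(L(f,χ₄,1)/Ω⁻)` are therefore absorbed by adding `n = 1` to
  both sides: every bound below is the printed one PLUS `n`, written out term by term in the docstrings.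
* `a_q = q + 1 − #Ẽ(𝔽_q)` (`aq W q`, `reductionPointCount`); `S_i` = `InS W i q` (`q` odd prime,
  `q ∤ N`, `a_q ≠ 2`, `v₂(a_q − 2) = i`); `S_i⁺` adds `q ≡ 1 (mod 4)`; "`q_i ∈ S₀ ∪ S₁ ∪ S₂` for all
  `i`" = every prime factor of `m` is in some `S_i`, `i ≤ 2`; `v_m` = `IsVm W m v` (a minimum, attained);
  `w_m`, `δ_{v_m,0}`, `δ_{v_m,2}` = `wOf v`, `δ₀ v`, `δ₂ v`; `r(m) = m.primeFactors.card`.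
No `_holds` expected (modular symbols `⟨r⟩^±`, Zhao's induction on `r(m)`). Consumers take
`(h : thm41_rectangular_n0)` etc.; the census conversion to BSD's `L(E^{(D)},1)/Ω(E^{(D)})` goes through
Pal 2012 (tree: `realPeriodRat_mul_sqrt_of_twist_of_neg`, `Pal2012/`).

## References
* [AdachiNomotoShii2026] Acta Arith. (2026), doi:10.4064/aa240320-5-10 = arXiv:2403.11474v3: §1
  (p. 1–3), §2 (p. 4), Thm. 2.1 (p. 5), §3 (pp. 5–10: `T_M`, `T₁`, `T₄`, Prop. 3.3, 3.9), §4 (pp. 10–14: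
  Thms. 4.1–4.4, Rem. 4.5, Table 1), §5 (pp. 14–17: `34a1`, `37a1` tables).
* [Zhai2016], [CaiLiZhai2019], [Zhai2021BSDExactFormulaTwists] (the special cases, loc. cit.);
  [Pal2012] (period of a twist); [CoatesLiTianZhai2015] (`leastRealPeriod`).
-/

noncomputable section

open scoped Classical MatrixGroups ModularForm

open CongruenceSubgroup NumberField WeierstrassCurve Literature.NumberTheory.EllipticCurves
  Literature.NumberTheory.EllipticCurves.ModularForms
  Literature.NumberTheory.EllipticCurves.Zhai2021
  Literature.NumberTheory.EllipticCurves.CoatesLiTianZhai2015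

namespace Literature.NumberTheory.EllipticCurves.AdachiNomotoShii2026

/-! ### §1. Vocabulary (definitions with bodies; nothing asserted) -/

/-- `v₂` on `ℚ` with `v₂(0) = +∞`, valued in `WithTop ℤ` (the paper's "`v₂` … normalized so that
`v₂(2) = 1`"; `⊤` renders the vanishing `L`-value). [cite: AdachiNomotoShii2026, §1 (arXiv p. 2 L14–L15)] -/
def val₂ (x : ℚ) : WithTop ℤ :=
  if x = 0 then ⊤ else ((padicValRat 2 x : ℤ) : WithTop ℤ)

/-- "`L_f` is rectangular" (`L_f = Ω_f⁺ℤ + iΩ_f⁻ℤ`): for the Néron lattice of the (globally minimal)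
model `W` this is the case `Δ(W) > 0` (see the MISPRINT note in the module docstring; the sign of `Δ`
is model-independent). [cite: AdachiNomotoShii2026, §1 (p. 2 L1–L11), §2 (5) (p. 4 L39–L71), §5 (p. 15 L1–L20)] -/
def IsRectangular (W : WeierstrassCurve ℚ) : Prop := 0 < W.Δ

/-- "`L_f` is non-rectangular" (`L_f = Ω_f⁺ℤ + ((Ω_f⁺ + iΩ_f⁻)/2)ℤ`): the case `Δ(W) < 0`.
[cite: AdachiNomotoShii2026, §1 (p. 2 L1–L11), §2 (5) (p. 4 L39–L71)] -/
def IsNonRectangular (W : WeierstrassCurve ℚ) : Prop := W.Δ < 0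

/-- The conductor `M` of the quadratic character `χ_M` cutting out `ℚ(√D)`, for `D = εm` odd
square-free: "`M = m` (`εm ≡ 1 mod 4`), `4m` (`εm ≡ 3 mod 4`)". [cite: AdachiNomotoShii2026, §1 (p. 1 L37–L43)] -/
def twistCharConductor (D : ℤ) : ℕ :=
  if D % 4 = 1 then D.natAbs else 4 * D.natAbs

/-- `n ∈ {0, 1}` with `M = 4ⁿ m`: `n = 0` iff `D = εm ≡ 1 (mod 4)`. [cite: AdachiNomotoShii2026, §1 (p. 1 L37–L43), §3 (p. 5 L20–L22)] -/
def nOf (D : ℤ) : ℕ :=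
  if D % 4 = 1 then 0 else 1

/-- `Ω_f^{sgn(χ_M)}` for the twist by `ℚ(√D)`: `sgn(χ_M) = χ_M(−1) = sign D`; `Ω_f⁺ = Ω_E⁺` = the least
positive real period (`leastRealPeriod`), `Ω_f⁻ = Ω_E⁻` = the least imaginary period
(`imaginaryPeriodRat`) of the globally minimal optimal model `W` (`L_E = L_f` under `ν_E = 1`).
[cite: AdachiNomotoShii2026, §2 (p. 4 L39–L74), Thm. 2.1 (p. 5 L4–L18)] -/
def periodSgn (W : WeierstrassCurve ℚ) (D : ℤ) : ℝ :=
  if 0 < D then leastRealPeriod W else W.imaginaryPeriodRat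

/-- THE CURRENCY: the rational `x` with `L(E^{(D)}, 1) = x · Ω_f^{sgn(χ_M)} / √M` on a model `WD` of the
twist (`x = ±T_M` of the paper, rational by Thm. 2.1 and `[r]^± ∈ ℚ`); the printed
`v₂(L(f,χ_M,1)/Ω_f^{sgn(χ_M)})` is `v₂(x) − n`. [cite: AdachiNomotoShii2026, Thm. 2.1 (p. 5 L4–L18); §3 (p. 6 L3–L11: T_M, T₁, T₄)] -/
def IsAlgPart (W WD : WeierstrassCurve ℚ) (D : ℤ) (x : ℚ) : Prop :=
  WD.entireLFunction 1 =
    (x : ℂ) * (periodSgn W D : ℂ) / (Real.sqrt (twistCharConductor D : ℝ) : ℂ)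

/-- `a_q = q + 1 − #Ẽ(𝔽_q)` at a prime `q ∤ N` (`reductionPointCount W q = #Ẽ(𝔽_q)`; "`N_q = q + 1 − a_q`
denotes the number of `𝔽_q`-rational points"). [cite: AdachiNomotoShii2026, §1 (p. 2 L43–L44)] -/
def aq (W : WeierstrassCurve ℚ) [W.IsGloballyMinimal] (q : ℕ) : ℤ :=
  (q : ℤ) + 1 - (W.reductionPointCount q : ℤ)

/-- `q ∈ S_i = {q : odd prime | q ∤ N, v₂(a_q − 2) = i}` (with `a_q ≠ 2`, i.e. the valuation is
finite). [cite: AdachiNomotoShii2026, §1 (p. 2 L13), §4 (p. 10 L104–L110)] -/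
def InS (W : WeierstrassCurve ℚ) [W.IsGloballyMinimal] (i : ℕ) (q : ℕ) : Prop :=
  q.Prime ∧ q ≠ 2 ∧ ¬ q ∣ W.conductorNorm ℤ ∧ aq W q ≠ 2 ∧ padicValInt 2 (aq W q - 2) = i

/-- `q ∈ S_i⁺` = `S_i` together with `sgn(χ_q) = +1`, i.e. `q ≡ 1 (mod 4)`.
[cite: AdachiNomotoShii2026, §4 (p. 10 L104–L110); §3 (p. 5 L2–L3)] -/
def InSPlus (W : WeierstrassCurve ℚ) [W.IsGloballyMinimal] (i : ℕ) (q : ℕ) : Prop :=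
  InS W i q ∧ q % 4 = 1

/-- `v = v_m = min_{q ∣ m prime} v₂(a_q − 2)` (a minimum over the prime factors of `m`, attained; all
`a_q ≠ 2`). [cite: AdachiNomotoShii2026, §4 (p. 10 L95–L99)] -/
def IsVm (W : WeierstrassCurve ℚ) [W.IsGloballyMinimal] (m : ℕ) (v : ℕ) : Prop :=
  (∀ q ∈ m.primeFactors, aq W q ≠ 2 ∧ v ≤ padicValInt 2 (aq W q - 2)) ∧
    ∃ q ∈ m.primeFactors, padicValInt 2 (aq W q - 2) = v

/-- `w_m · r(m)` with "`w_m = 0` (`v_m = 0`), `1` (`v_m ≥ 1`)". [cite: AdachiNomotoShii2026, §4 (p. 10 L99–L103)] -/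
def wr (v r : ℕ) : ℤ := if v = 0 then 0 else r

/-- The Kronecker delta `δ_{v_m,0}`. [cite: AdachiNomotoShii2026, §4 (p. 11 L3)] -/
def δ₀ (v : ℕ) : ℤ := if v = 0 then 1 else 0

/-- The Kronecker delta `δ_{v_m,2}`. [cite: AdachiNomotoShii2026, §4 (p. 11 L3)] -/
def δ₂ (v : ℕ) : ℤ := if v = 2 then 1 else 0

/-- The common setting of Thms. 4.1–4.4 for the pair (`m`, `D = εm`): `m` square-free, odd, with
`r(m) ≥ 1` prime factors; `|D| = m`; `n = nOf D` as prescribed; "`(M, N) = 1`" (`m` coprime to `N`,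
and `N` odd when `n = 1`). [cite: AdachiNomotoShii2026, §3 (p. 5 L20–L22), §4 (p. 10 L93–L95)] -/
def TwistSetting (N : ℕ) (m : ℕ) (D : ℤ) (n : ℕ) : Prop :=
  Squarefree m ∧ ¬ 2 ∣ m ∧ m.primeFactors.Nonempty ∧ D.natAbs = m ∧ nOf D = n ∧
    Nat.Coprime m N ∧ (n = 1 → ¬ 2 ∣ N)

/-! ### §2. The printed theorems (named facts; nothing asserted)

Common shape: `W` globally minimal and OPTIMAL with Manin constant `1` (`IsOptimalDatum W Dt`,
`Dt.c.natAbs = 1`), `x₁` the rational with `L(E,1) = x₁ Ω⁺(E)` (`T₁`), for `n = 1` also `x₄` with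
`L(E^{(−1)},1) = x₄ Ω⁻(E)/2` on a globally minimal model `W4` of the twist by `−1` (`x₄ = T₄`,
`v₂(L(f,χ₄,1)/Ω_f⁻) = v₂(x₄) − 1`); `(m, D, v)` as in `TwistSetting` / `IsVm`; `WD` a globally minimal
model of `E^{(D)}`. Conclusions: `∃ x, IsAlgPart W WD D x ∧ val₂ x ≥ (printed bound) + n`
`∧ (printed equality condition → val₂ x = (printed bound) + n)`. -/

/-- **Adachi–Nomoto–Shii 2026, Theorem 4.1 (rectangular, `n = 0`)** (verbatim in the module docstring;
`IsRectangular W`, `D ≡ 1 (mod 4)`, so `M = m` and the printed valuation is `val₂ x` itself).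
(i) all `q ∣ m` in `S₀ ∪ S₁ ∪ S₂`: `val₂ x ≥ w_m r(m) + min{δ_{v_m,0}, val₂ x₁}` (12).
(ii) all `q ∣ m` in `S₀⁺ ∪ S₁⁺ ∪ S₂⁺`: `val₂ x ≥ w_m r(m) + min{1 + δ_{v_m,0}, val₂ x₁ + δ_{v_m,2}}` (13),
with EQUALITY if (`val₂ x₁ = 1` and all `q ∈ S₀⁺`) or (`val₂ x₁ < 1` and all `q ∈ S₁⁺`).
AT 2, analytic side, `E` optimal with `ν_E = 1`. No `_holds` expected.
[cite: AdachiNomotoShii2026, Thm. 4.1 (arXiv:2403.11474 p. 11 L4–L51)] -/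
def thm41_rectangular_n0 : Prop :=
  ∀ (W : WeierstrassCurve ℚ) [W.IsElliptic] [W.IsGloballyMinimal] [NeZero (W.conductorNorm ℤ)]
    (Dt : ModularParametrizationData W (W.conductorNorm ℤ)),
    IsOptimalDatum W Dt → Dt.c.natAbs = 1 → IsRectangular W →
    ∀ (x₁ : ℚ), W.entireLFunction 1 = (x₁ : ℂ) * (leastRealPeriod W : ℂ) →
    ∀ (m : ℕ) (D : ℤ) (v : ℕ), TwistSetting (W.conductorNorm ℤ) m D 0 → IsVm W m v →
    ∀ (WD : WeierstrassCurve ℚ) [WD.IsElliptic] [WD.IsGloballyMinimal],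
      (∃ C : VariableChange ℚ, C • W.quadraticTwist (D : ℚ) = WD) →
      -- (i)
      ((∀ q ∈ m.primeFactors, ∃ i ≤ 2, InS W i q) →
        ∃ x : ℚ, IsAlgPart W WD D x ∧
          ((wr v m.primeFactors.card : ℤ) : WithTop ℤ) + min ((δ₀ v : ℤ) : WithTop ℤ) (val₂ x₁)
            ≤ val₂ x) ∧
      -- (ii)
      ((∀ q ∈ m.primeFactors, ∃ i ≤ 2, InSPlus W i q) →
        ∃ x : ℚ, IsAlgPart W WD D x ∧
          ((wr v m.primeFactors.card : ℤ) : WithTop ℤ) +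
              min ((1 + δ₀ v : ℤ) : WithTop ℤ) (val₂ x₁ + ((δ₂ v : ℤ) : WithTop ℤ)) ≤ val₂ x ∧
          ((val₂ x₁ = 1 ∧ ∀ q ∈ m.primeFactors, InSPlus W 0 q) ∨
              (val₂ x₁ < 1 ∧ ∀ q ∈ m.primeFactors, InSPlus W 1 q) →
            val₂ x = ((wr v m.primeFactors.card : ℤ) : WithTop ℤ) +
              min ((1 + δ₀ v : ℤ) : WithTop ℤ) (val₂ x₁ + ((δ₂ v : ℤ) : WithTop ℤ))))

/-- **Adachi–Nomoto–Shii 2026, Theorem 4.2 (non-rectangular, `n = 0`)** (verbatim in the module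
docstring; `IsNonRectangular W`, `D ≡ 1 (mod 4)`).
(i) all `q ∣ m` in `S₀ ∪ S₁ ∪ S₂`: `val₂ x ≥ w_m r(m) + min{δ_{v_m,0}, val₂ x₁}` (14), with EQUALITY if
`val₂ x₁ = 0` and all `q ∈ S₀` (Zhai 2016 Thm. 1.1 is the special case `E[2](ℚ) = 0`, `q` inert).
(ii) all `q ∣ m` in `S₀⁺ ∪ S₁⁺ ∪ S₂⁺`: `val₂ x ≥ w_m r(m) + min{δ_{v_m,0}, val₂ x₁ + δ_{v_m,2}}` (15), with
EQUALITY if (`val₂ x₁ = 0` and all `q ∈ S₀⁺`) or (`val₂ x₁ < 0` and all `q ∈ S₁⁺`) (Cai–Li–Zhai 2020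
Thm. 1.1 is a special case). AT 2, analytic side. No `_holds` expected.
[cite: AdachiNomotoShii2026, Thm. 4.2 (arXiv:2403.11474 p. 11 L52–L102)] -/
def thm42_nonRectangular_n0 : Prop :=
  ∀ (W : WeierstrassCurve ℚ) [W.IsElliptic] [W.IsGloballyMinimal] [NeZero (W.conductorNorm ℤ)]
    (Dt : ModularParametrizationData W (W.conductorNorm ℤ)),
    IsOptimalDatum W Dt → Dt.c.natAbs = 1 → IsNonRectangular W →
    ∀ (x₁ : ℚ), W.entireLFunction 1 = (x₁ : ℂ) * (leastRealPeriod W : ℂ) →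
    ∀ (m : ℕ) (D : ℤ) (v : ℕ), TwistSetting (W.conductorNorm ℤ) m D 0 → IsVm W m v →
    ∀ (WD : WeierstrassCurve ℚ) [WD.IsElliptic] [WD.IsGloballyMinimal],
      (∃ C : VariableChange ℚ, C • W.quadraticTwist (D : ℚ) = WD) →
      -- (i)
      ((∀ q ∈ m.primeFactors, ∃ i ≤ 2, InS W i q) →
        ∃ x : ℚ, IsAlgPart W WD D x ∧
          ((wr v m.primeFactors.card : ℤ) : WithTop ℤ) + min ((δ₀ v : ℤ) : WithTop ℤ) (val₂ x₁)
            ≤ val₂ x ∧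
          (val₂ x₁ = 0 ∧ (∀ q ∈ m.primeFactors, InS W 0 q) →
            val₂ x = ((wr v m.primeFactors.card : ℤ) : WithTop ℤ) +
              min ((δ₀ v : ℤ) : WithTop ℤ) (val₂ x₁))) ∧
      -- (ii)
      ((∀ q ∈ m.primeFactors, ∃ i ≤ 2, InSPlus W i q) →
        ∃ x : ℚ, IsAlgPart W WD D x ∧
          ((wr v m.primeFactors.card : ℤ) : WithTop ℤ) +
              min ((δ₀ v : ℤ) : WithTop ℤ) (val₂ x₁ + ((δ₂ v : ℤ) : WithTop ℤ)) ≤ val₂ x ∧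
          ((val₂ x₁ = 0 ∧ ∀ q ∈ m.primeFactors, InSPlus W 0 q) ∨
              (val₂ x₁ < 0 ∧ ∀ q ∈ m.primeFactors, InSPlus W 1 q) →
            val₂ x = ((wr v m.primeFactors.card : ℤ) : WithTop ℤ) +
              min ((δ₀ v : ℤ) : WithTop ℤ) (val₂ x₁ + ((δ₂ v : ℤ) : WithTop ℤ))))

/-- **Adachi–Nomoto–Shii 2026, Theorem 4.3 (rectangular, `n = 1`)** (verbatim in the module docstring;
`IsRectangular W`, `D ≡ 3 (mod 4)`, `M = 4m`, `N` odd; the printed valuations are `val₂ x − 1` and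
`v₂(L(f,χ₄,1)/Ω_f⁻) = val₂ x₄ − 1`, so both sides are shifted by `+1` below).
(i) all `q ∣ m` in `S₀ ∪ S₁ ∪ S₂`: printed
`≥ w_m r + min{−1 + δ_{v_m,0}, −1 + δ_{v_m,0} + v₂(T₁), v₂(L(f,χ₄,1)/Ω⁻) + δ_{v_m,2}}` (16), i.e.
`val₂ x ≥ w_m r + min{δ_{v_m,0}, δ_{v_m,0} + val₂ x₁, val₂ x₄ + δ_{v_m,2}}`.
(ii) all `q ∣ m` in `S⁺`: printed `≥ w_m r + min{δ_{v_m,0}, v₂(L(f,χ₄,1)/Ω⁻) + δ_{v_m,2}}` (17), i.e.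
`val₂ x ≥ w_m r + min{δ_{v_m,0} + 1, val₂ x₄ + δ_{v_m,2}}`, with EQUALITY if `v₂(L(f,χ₄,1)/Ω⁻) = 0`
(`val₂ x₄ = 1`) and all `q ∈ S₀⁺` (the `37a1` example of §1/§5.2). AT 2, analytic side. No `_holds`
expected. [cite: AdachiNomotoShii2026, Thm. 4.3 (arXiv:2403.11474 p. 11 L103–L157)] -/
def thm43_rectangular_n1 : Prop :=
  ∀ (W : WeierstrassCurve ℚ) [W.IsElliptic] [W.IsGloballyMinimal] [NeZero (W.conductorNorm ℤ)]
    (Dt : ModularParametrizationData W (W.conductorNorm ℤ)),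
    IsOptimalDatum W Dt → Dt.c.natAbs = 1 → IsRectangular W →
    ∀ (x₁ : ℚ), W.entireLFunction 1 = (x₁ : ℂ) * (leastRealPeriod W : ℂ) →
    ∀ (W4 : WeierstrassCurve ℚ) [W4.IsElliptic] [W4.IsGloballyMinimal],
      (∃ C : VariableChange ℚ, C • W.quadraticTwist (-1 : ℚ) = W4) →
    ∀ (x₄ : ℚ), IsAlgPart W W4 (-1) x₄ →
    ∀ (m : ℕ) (D : ℤ) (v : ℕ), TwistSetting (W.conductorNorm ℤ) m D 1 → IsVm W m v →
    ∀ (WD : WeierstrassCurve ℚ) [WD.IsElliptic] [WD.IsGloballyMinimal],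
      (∃ C : VariableChange ℚ, C • W.quadraticTwist (D : ℚ) = WD) →
      -- (i)
      ((∀ q ∈ m.primeFactors, ∃ i ≤ 2, InS W i q) →
        ∃ x : ℚ, IsAlgPart W WD D x ∧
          ((wr v m.primeFactors.card : ℤ) : WithTop ℤ) +
              min (min ((δ₀ v : ℤ) : WithTop ℤ) (((δ₀ v : ℤ) : WithTop ℤ) + val₂ x₁))
                (val₂ x₄ + ((δ₂ v : ℤ) : WithTop ℤ)) ≤ val₂ x) ∧
      -- (ii)
      ((∀ q ∈ m.primeFactors, ∃ i ≤ 2, InSPlus W i q) →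
        ∃ x : ℚ, IsAlgPart W WD D x ∧
          ((wr v m.primeFactors.card : ℤ) : WithTop ℤ) +
              min ((δ₀ v + 1 : ℤ) : WithTop ℤ) (val₂ x₄ + ((δ₂ v : ℤ) : WithTop ℤ)) ≤ val₂ x ∧
          (val₂ x₄ = 1 ∧ (∀ q ∈ m.primeFactors, InSPlus W 0 q) →
            val₂ x = ((wr v m.primeFactors.card : ℤ) : WithTop ℤ) +
              min ((δ₀ v + 1 : ℤ) : WithTop ℤ) (val₂ x₄ + ((δ₂ v : ℤ) : WithTop ℤ))))

/-- **Adachi–Nomoto–Shii 2026, Theorem 4.4 (non-rectangular, `n = 1`)** (verbatim in the module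
docstring; `IsNonRectangular W`, `D ≡ 3 (mod 4)`, `M = 4m`, `N` odd; shifts by `+1` as in Thm. 4.3).
(i) all `q ∣ m` in `S₀ ∪ S₁ ∪ S₂`: printed
`≥ w_m r + min{−1 + δ_{v_m,0}, −1 + δ_{v_m,0} + v₂(T₁), v₂(L(f,χ₄,1)/Ω⁻) + δ_{v_m,2}}` (18), i.e.
`val₂ x ≥ w_m r + min{δ_{v_m,0}, δ_{v_m,0} + val₂ x₁, val₂ x₄ + δ_{v_m,2}}`, with EQUALITY if
`v₂(L(f,χ₄,1)/Ω⁻) = −1` (`val₂ x₄ = 0`) and all `q ∈ S₀`.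
(ii) all `q ∣ m` in `S⁺`: printed `≥ w_m r + min{−1 + δ_{v_m,0}, v₂(L(f,χ₄,1)/Ω⁻) + δ_{v_m,2}}` (19),
i.e. `val₂ x ≥ w_m r + min{δ_{v_m,0}, val₂ x₄ + δ_{v_m,2}}`, with EQUALITY if `val₂ x₄ = 0` and all
`q ∈ S₀⁺`. AT 2, analytic side. No `_holds` expected.
[cite: AdachiNomotoShii2026, Thm. 4.4 (arXiv:2403.11474 p. 12 L1–L58)] -/
def thm44_nonRectangular_n1 : Prop :=
  ∀ (W : WeierstrassCurve ℚ) [W.IsElliptic] [W.IsGloballyMinimal] [NeZero (W.conductorNorm ℤ)]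
    (Dt : ModularParametrizationData W (W.conductorNorm ℤ)),
    IsOptimalDatum W Dt → Dt.c.natAbs = 1 → IsNonRectangular W →
    ∀ (x₁ : ℚ), W.entireLFunction 1 = (x₁ : ℂ) * (leastRealPeriod W : ℂ) →
    ∀ (W4 : WeierstrassCurve ℚ) [W4.IsElliptic] [W4.IsGloballyMinimal],
      (∃ C : VariableChange ℚ, C • W.quadraticTwist (-1 : ℚ) = W4) →
    ∀ (x₄ : ℚ), IsAlgPart W W4 (-1) x₄ →
    ∀ (m : ℕ) (D : ℤ) (v : ℕ), TwistSetting (W.conductorNorm ℤ) m D 1 → IsVm W m v →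
    ∀ (WD : WeierstrassCurve ℚ) [WD.IsElliptic] [WD.IsGloballyMinimal],
      (∃ C : VariableChange ℚ, C • W.quadraticTwist (D : ℚ) = WD) →
      -- (i)
      ((∀ q ∈ m.primeFactors, ∃ i ≤ 2, InS W i q) →
        ∃ x : ℚ, IsAlgPart W WD D x ∧
          ((wr v m.primeFactors.card : ℤ) : WithTop ℤ) +
              min (min ((δ₀ v : ℤ) : WithTop ℤ) (((δ₀ v : ℤ) : WithTop ℤ) + val₂ x₁))
                (val₂ x₄ + ((δ₂ v : ℤ) : WithTop ℤ)) ≤ val₂ x ∧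
          (val₂ x₄ = 0 ∧ (∀ q ∈ m.primeFactors, InS W 0 q) →
            val₂ x = ((wr v m.primeFactors.card : ℤ) : WithTop ℤ) +
              min (min ((δ₀ v : ℤ) : WithTop ℤ) (((δ₀ v : ℤ) : WithTop ℤ) + val₂ x₁))
                (val₂ x₄ + ((δ₂ v : ℤ) : WithTop ℤ)))) ∧
      -- (ii)
      ((∀ q ∈ m.primeFactors, ∃ i ≤ 2, InSPlus W i q) →
        ∃ x : ℚ, IsAlgPart W WD D x ∧
          ((wr v m.primeFactors.card : ℤ) : WithTop ℤ) +
              min ((δ₀ v : ℤ) : WithTop ℤ) (val₂ x₄ + ((δ₂ v : ℤ) : WithTop ℤ)) ≤ val₂ x ∧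
          (val₂ x₄ = 0 ∧ (∀ q ∈ m.primeFactors, InSPlus W 0 q) →
            val₂ x = ((wr v m.primeFactors.card : ℤ) : WithTop ℤ) +
              min ((δ₀ v : ℤ) : WithTop ℤ) (val₂ x₄ + ((δ₂ v : ℤ) : WithTop ℤ))))

/-! ### §3. Bookkeeping (proved) -/

/-- `val₂ 0 = ⊤` (a vanishing value satisfies every printed lower bound and no printed equality).
[cite: AdachiNomotoShii2026, §1 (p. 2 L14–L15)] -/
theorem val₂_zero : val₂ 0 = ⊤ := if_pos rfl

/-- `val₂ x = v₂ x` for `x ≠ 0`. [cite: AdachiNomotoShii2026, §1 (p. 2 L14–L15)] -/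
theorem val₂_of_ne_zero {x : ℚ} (hx : x ≠ 0) : val₂ x = ((padicValRat 2 x : ℤ) : WithTop ℤ) :=
  if_neg hx

/-- A finite `val₂` forces `x ≠ 0` (so every printed EQUALITY case carries `L(E^{(D)},1) ≠ 0`).
[cite: AdachiNomotoShii2026, Thm. 1.1 (p. 2 L27–L29: "the Mordell–Weil group … and Ш … are finite for such M")] -/
theorem ne_zero_of_val₂_ne_top {x : ℚ} (h : val₂ x ≠ ⊤) : x ≠ 0 := by
  intro hx
  exact h (hx ▸ val₂_zero)

/-- `M = m` for `D ≡ 1 (mod 4)` and `M = 4m` otherwise (`m = |D|`).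
[cite: AdachiNomotoShii2026, §1 (p. 1 L37–L43)] -/
theorem twistCharConductor_of_mod_four_eq_one {D : ℤ} (h : D % 4 = 1) :
    twistCharConductor D = D.natAbs := if_pos h

/-- `M = 4m` for `D ≢ 1 (mod 4)`. [cite: AdachiNomotoShii2026, §1 (p. 1 L37–L43)] -/
theorem twistCharConductor_of_mod_four_ne_one {D : ℤ} (h : D % 4 ≠ 1) :
    twistCharConductor D = 4 * D.natAbs := if_neg h

/-- The `χ₄` anchor: for the twist by `−1`, `M = 4` and the period is `Ω⁻` (so
`L(E^{(−1)},1) = x₄ · Ω⁻(E)/2` and `v₂(L(f,χ₄,1)/Ω_f⁻) = v₂(x₄) − 1`, `x₄ = T₄ = 2[1/4]⁻`).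
[cite: AdachiNomotoShii2026, §3 (p. 6 L10–L11)] -/
theorem twistCharConductor_neg_one : twistCharConductor (-1) = 4 ∧ nOf (-1) = 1 ∧
    ∀ W : WeierstrassCurve ℚ, periodSgn W (-1) = W.imaginaryPeriodRat := by
  refine ⟨by decide, by decide, fun W => ?_⟩
  simp [periodSgn]

/-- `S_i⁺ ⊆ S_i`. [cite: AdachiNomotoShii2026, §4 (p. 10 L104–L110)] -/
theorem InSPlus.inS {W : WeierstrassCurve ℚ} [W.IsGloballyMinimal] {i q : ℕ} (h : InSPlus W i q) :
    InS W i q := h.1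

end Literature.NumberTheory.EllipticCurves.AdachiNomotoShii2026

end
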